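import Summits.AtomisticToContinuum.FouriersLaw.Theorems.OddSectorIrreversibilitySubBallisticWindowSaturationEnvelope

/-!
# `SubBallisticWindow` (stmt-AtomisticToContinuum-14070): the open core band, isolated

Support file for crux `Summit.AtomisticToContinuum.FouriersLaw.Theses.OddSectorIrreversibility.SubBallisticWindow`
(E2 of route OddSectorIrreversibility), line `Sketch`. Notation as in `…SubBallisticWindowPartial`
(`V_B(τ) = ∫ (∫_{(0,τ]} (P⁰_t J_B)(x) dt)² e^{-H(x)/T} dx`, `ℓ = k₂ - k₁`, `d = min(k₁, N - k₂)`, `Z = ∫ e^{-H/T}`).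

The landed `N`-uniform partial results prove the crux inequality `V_B(τ) ≤ C (1+τ) ℓ Z` OUTSIDE the band
`{ℓ > ℓ₀, τ > τ₀, 1 + τ < ℓ (ℓ + d)}`: `…Partial.boundedBlocks` (`ℓ ≤ ℓ₀`), `boundedWindows` below (`τ ≤ τ₀`, the
static envelope; `…Partial.shortWindows` is `τ₀ = 1`), `…SaturationEnvelope.lateWindows` (`ℓ (ℓ + d) ≤ 1 + τ`). This
file records the resulting EXACT LOCALISATION of the open content of E2 as theorems a planner can cite:

* `boundedWindows` — E2 on windows `τ ≤ τ₀`, for every `τ₀` (constant `2 max(τ₀,0) C_J`);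
* `subBallisticWindow_of_coreBand` — for ANY thresholds `ℓ₀ : ℕ`, `τ₀ : ℝ`: the crux inequality on the core band
  `{k₁ + ℓ₀ < k₂, τ₀ < τ, 1 + τ < ℓ (ℓ + d)}` (uniformly in `N`) implies `SubBallisticWindow`;
* `coreBand_of_subBallisticWindow` — the converse restriction (trivial);
* `subBallisticWindow_iff_coreBand` — `SubBallisticWindow ↔ ∃ ℓ₀ τ₀, (E2 on the core band beyond ℓ₀, τ₀)`.

So the crux is EXACTLY the statement "for long blocks, on windows that are long but earlier than the saturation
time `ℓ (ℓ + d)` of the cheaper plateau energy, the windowed block transport is at most diffusive, uniformly in the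
volume" — the `N`-uniform dynamical decorrelation content (open in print, BLR2000 §6.3). Bookkeeping only; nothing
here closes the item. Lead c4 of line `Sketch`, 2026-08-17.
-/

noncomputable section

namespace Summit.AtomisticToContinuum.FouriersLaw.Theorems.SubBallisticWindow.CoreBand

open MeasureTheory Filter Topology Set
open scoped NNReal ENNReal
open Literature.MathematicalPhysics.KineticTheory.HeatConduction
open Summit.AtomisticToContinuum.FouriersLaw.Theorems.ClosedConeSensitivity.Negative.ZeroFrictionDictionary
open Summit.AtomisticToContinuum.FouriersLaw.Theorems.OddSectorWitness
open Summit.AtomisticToContinuum.FouriersLaw.Theses.OddSectorIrreversibility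

/-- **E2 on bounded windows** (`N`-uniform). For `ω₂ > 0`, `lam, β ≥ 0`, any `γ`, `T > 0` and every `τ₀` there
is `C = 2 max(τ₀,0) C_J` with, for every `N`, block `k₁ ≤ k₂` and window `0 ≤ τ ≤ τ₀`,
`∫ (∫_{(0,τ]} (P⁰_t J_B)(x) dt)² e^{-H(x)/T} dx ≤ C (1 + τ) (k₂ - k₁) Z` (the static envelope `2 τ² C_J ℓ Z` and
`τ² ≤ τ₀ (1 + τ)`). [folklore] -/
theorem boundedWindows :
    ∀ ω₂ lam β γ : ℝ, 0 < ω₂ → 0 ≤ lam → 0 ≤ β → ∀ T : ℝ, 0 < T → ∀ τ₀ : ℝ, ∃ C : ℝ, ∀ (N k₁ k₂ : ℕ), k₁ ≤ k₂ →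
      ∀ τ : ℝ, 0 ≤ τ → τ ≤ τ₀ →
      let P := pinnedChain ω₂ lam β γ;
      let P₀ := pinnedChain ω₂ lam β 0;
      let μT : Measure (PhaseSpace N) :=
        volume.withDensity (fun x : PhaseSpace N => ENNReal.ofReal (Real.exp (-(P.hamiltonian N x) / T)));
      let JB : PhaseSpace N → ℝ := fun z => ∑ i : Fin N,
        (if k₁ ≤ i.val ∧ i.val < k₂ then P.bondCurrent N i z else 0);
      ∫ x, (∫ t in Set.Ioc (0 : ℝ) τ, (∫ y, JB y ∂(P₀.transitionKernel N T T t.toNNReal x))) ^ 2 ∂μT ≤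
        C * (1 + τ) * ((k₂ : ℝ) - k₁) * ∫ x, Real.exp (-(P.hamiltonian N x) / T) ∂volume := by
  intro ω₂ lam β γ hω hl hβ T hT τ₀
  obtain ⟨CJ, CE, hCJ0, -, hstat, -⟩ := Partial.exists_envelopes hω hl hβ γ hT
  refine ⟨2 * max τ₀ 0 * CJ, fun N k₁ k₂ hk τ hτ hττ₀ => ?_⟩
  simp only
  set Z := ∫ y, Real.exp (-((pinnedChain ω₂ lam β γ).hamiltonian N y) / T) ∂volume with hZ
  have hZ0 : 0 ≤ Z := integral_nonneg fun _ => (Real.exp_pos _).le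
  have hℓ0 : (0 : ℝ) ≤ (k₂ : ℝ) - k₁ := sub_nonneg.mpr (by exact_mod_cast hk)
  have hdict := Partial.integral_window_kernel_eq hω hl hβ γ N k₁ k₂ T τ (gibbsWeight ω₂ lam β γ N T)
  simp only [blockCurrent] at hdict
  rw [show (volume.withDensity fun x : PhaseSpace N =>
      ENNReal.ofReal (Real.exp (-((pinnedChain ω₂ lam β γ).hamiltonian N x) / T))) =
      gibbsWeight ω₂ lam β γ N T from rfl, hdict]
  have h1 := hstat N k₁ k₂ hk τ hτ
  simp only [blockCurrent] at h1
  refine h1.trans ?_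
  have hτm : τ ≤ max τ₀ 0 := hττ₀.trans (le_max_left _ _)
  have hm0 : 0 ≤ max τ₀ 0 := le_max_right _ _
  have hτ2 : τ ^ 2 ≤ max τ₀ 0 * (1 + τ) := by nlinarith
  have h0 : 0 ≤ CJ * ((k₂ : ℝ) - k₁) * Z := by positivity
  calc 2 * τ ^ 2 * (CJ * ((k₂ : ℝ) - k₁) * Z) ≤ 2 * (max τ₀ 0 * (1 + τ)) * (CJ * ((k₂ : ℝ) - k₁) * Z) := by
        nlinarith
    _ = 2 * max τ₀ 0 * CJ * (1 + τ) * ((k₂ : ℝ) - k₁) * Z := by ring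

/-- **The core band suffices.** Fix ANY thresholds `ℓ₀ : ℕ`, `τ₀ : ℝ`. If for all parameters `> 0` and `T > 0`
there is `C` such that the crux inequality `V_B(τ) ≤ C (1+τ) ℓ Z` holds for every `N`, every block with
`k₁ + ℓ₀ < k₂` (`k₂ + 1 ≤ N`) and every window with `τ₀ < τ` and `1 + τ < ℓ (ℓ + min(k₁, N - k₂))` (BEFORE the
saturation time of the cheaper plateau), then `SubBallisticWindow` holds — the complement of the band is covered,
uniformly in `N`, by `Partial.boundedBlocks ℓ₀`, `boundedWindows τ₀` and `SaturationEnvelope.lateWindows`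
(constant: the sum of the four nonnegative constants). [folklore] -/
theorem subBallisticWindow_of_coreBand (ℓ₀ : ℕ) (τ₀ : ℝ)
    (hcore : ∀ ω₂ lam β γ : ℝ, 0 < ω₂ → 0 < lam → 0 < β → 0 < γ → ∀ T : ℝ, 0 < T → ∃ C : ℝ,
      ∀ (N k₁ k₂ : ℕ), k₁ ≤ k₂ → k₂ + 1 ≤ N → k₁ + ℓ₀ < k₂ → ∀ τ : ℝ, 0 ≤ τ → τ₀ < τ →
      1 + τ < ((k₂ : ℝ) - k₁) * (((k₂ : ℝ) - k₁) + min (k₁ : ℝ) ((N : ℝ) - k₂)) →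
      let P := pinnedChain ω₂ lam β γ;
      let P₀ := pinnedChain ω₂ lam β 0;
      let μT : Measure (PhaseSpace N) :=
        volume.withDensity (fun x : PhaseSpace N => ENNReal.ofReal (Real.exp (-(P.hamiltonian N x) / T)));
      let JB : PhaseSpace N → ℝ := fun z => ∑ i : Fin N,
        (if k₁ ≤ i.val ∧ i.val < k₂ then P.bondCurrent N i z else 0);
      ∫ x, (∫ t in Set.Ioc (0 : ℝ) τ, (∫ y, JB y ∂(P₀.transitionKernel N T T t.toNNReal x))) ^ 2 ∂μT ≤
        C * (1 + τ) * ((k₂ : ℝ) - k₁) * ∫ x, Real.exp (-(P.hamiltonian N x) / T) ∂volume) :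
    SubBallisticWindow := by
  intro ω₂ lam β γ hω hl hβ hγ T hT
  obtain ⟨C1, hC1⟩ := Partial.boundedBlocks ω₂ lam β γ hω hl.le hβ.le T hT ℓ₀
  obtain ⟨C2, hC2⟩ := boundedWindows ω₂ lam β γ hω hl.le hβ.le T hT τ₀
  obtain ⟨C3, hC3⟩ := SaturationEnvelope.lateWindows ω₂ lam β γ hω hl.le hβ.le T hT
  obtain ⟨C4, hC4⟩ := hcore ω₂ lam β γ hω hl hβ hγ T hT
  refine ⟨max C1 0 + max C2 0 + max C3 0 + max C4 0, fun N k₁ k₂ hk hkN τ hτ => ?_⟩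
  simp only
  set Z := ∫ y, Real.exp (-((pinnedChain ω₂ lam β γ).hamiltonian N y) / T) ∂volume with hZ
  have hZ0 : 0 ≤ Z := integral_nonneg fun _ => (Real.exp_pos _).le
  have hℓ0 : (0 : ℝ) ≤ (k₂ : ℝ) - k₁ := sub_nonneg.mpr (by exact_mod_cast hk)
  have hW0 : 0 ≤ (1 + τ) * ((k₂ : ℝ) - k₁) * Z := by
    have : 0 ≤ 1 + τ := by linarith
    positivity
  have hC10 : 0 ≤ max C1 0 := le_max_right _ _
  have hC20 : 0 ≤ max C2 0 := le_max_right _ _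
  have hC30 : 0 ≤ max C3 0 := le_max_right _ _
  have hC40 : 0 ≤ max C4 0 := le_max_right _ _
  -- a bound by `K · envelope` with `K ≤` the total constant suffices
  have hsum : ∀ {X K : ℝ}, X ≤ K * (1 + τ) * ((k₂ : ℝ) - k₁) * Z →
      K ≤ max C1 0 + max C2 0 + max C3 0 + max C4 0 →
      X ≤ (max C1 0 + max C2 0 + max C3 0 + max C4 0) * (1 + τ) * ((k₂ : ℝ) - k₁) * Z := by
    intro X K h hK
    calc X ≤ K * (1 + τ) * ((k₂ : ℝ) - k₁) * Z := h
      _ = K * ((1 + τ) * ((k₂ : ℝ) - k₁) * Z) := by ring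
      _ ≤ max K 0 * ((1 + τ) * ((k₂ : ℝ) - k₁) * Z) := mul_le_mul_of_nonneg_right (le_max_left _ _) hW0
      _ ≤ (max C1 0 + max C2 0 + max C3 0 + max C4 0) * ((1 + τ) * ((k₂ : ℝ) - k₁) * Z) :=
          mul_le_mul_of_nonneg_right (max_le (hK) (by linarith)) hW0
      _ = _ := by ring
  rcases le_or_gt k₂ (k₁ + ℓ₀) with hℓ | hℓ
  · -- blocks of length `≤ ℓ₀`
    have h1 := hC1 N k₁ k₂ hk hℓ hkN τ hτ
    simp only at h1
    exact hsum h1 (by linarith [le_max_left C1 0])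
  rcases le_or_gt τ τ₀ with hτ' | hτ'
  · -- windows `≤ τ₀`
    have h1 := hC2 N k₁ k₂ hk τ hτ hτ'
    simp only at h1
    exact hsum h1 (by linarith [le_max_left C2 0])
  rcases le_or_gt (((k₂ : ℝ) - k₁) * (((k₂ : ℝ) - k₁) + min (k₁ : ℝ) ((N : ℝ) - k₂))) (1 + τ) with hlate | hearly
  · -- late windows
    have h1 := hC3 N k₁ k₂ hk hkN τ hτ hlate
    simp only at h1
    exact hsum h1 (by linarith [le_max_left C3 0])
  · -- the core band
    have h1 := hC4 N k₁ k₂ hk hkN hℓ τ hτ hτ' hearly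
    simp only at h1
    exact hsum h1 (by linarith [le_max_left C4 0])

/-- The crux restricted to the core band (any thresholds): trivial direction. [folklore] -/
theorem coreBand_of_subBallisticWindow (ℓ₀ : ℕ) (τ₀ : ℝ) (hE2 : SubBallisticWindow) :
    ∀ ω₂ lam β γ : ℝ, 0 < ω₂ → 0 < lam → 0 < β → 0 < γ → ∀ T : ℝ, 0 < T → ∃ C : ℝ,
      ∀ (N k₁ k₂ : ℕ), k₁ ≤ k₂ → k₂ + 1 ≤ N → k₁ + ℓ₀ < k₂ → ∀ τ : ℝ, 0 ≤ τ → τ₀ < τ →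
      1 + τ < ((k₂ : ℝ) - k₁) * (((k₂ : ℝ) - k₁) + min (k₁ : ℝ) ((N : ℝ) - k₂)) →
      let P := pinnedChain ω₂ lam β γ;
      let P₀ := pinnedChain ω₂ lam β 0;
      let μT : Measure (PhaseSpace N) :=
        volume.withDensity (fun x : PhaseSpace N => ENNReal.ofReal (Real.exp (-(P.hamiltonian N x) / T)));
      let JB : PhaseSpace N → ℝ := fun z => ∑ i : Fin N,
        (if k₁ ≤ i.val ∧ i.val < k₂ then P.bondCurrent N i z else 0);
      ∫ x, (∫ t in Set.Ioc (0 : ℝ) τ, (∫ y, JB y ∂(P₀.transitionKernel N T T t.toNNReal x))) ^ 2 ∂μT ≤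
        C * (1 + τ) * ((k₂ : ℝ) - k₁) * ∫ x, Real.exp (-(P.hamiltonian N x) / T) ∂volume := by
  intro ω₂ lam β γ hω hl hβ hγ T hT
  obtain ⟨C, hC⟩ := hE2 ω₂ lam β γ hω hl hβ hγ T hT
  exact ⟨C, fun N k₁ k₂ hk hkN _ τ hτ _ _ => hC N k₁ k₂ hk hkN τ hτ⟩

/-- **`SubBallisticWindow` ⟺ its core band.** The crux E2 holds if and only if, for SOME thresholds `ℓ₀, τ₀`,
the crux inequality holds (uniformly in `N`) on the core band `{k₁ + ℓ₀ < k₂, τ₀ < τ, 1 + τ < ℓ (ℓ + min(k₁, N-k₂))}`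
— long blocks, long windows, before plateau saturation. Everything else is a landed `N`-uniform theorem
(`Partial.boundedBlocks`, `boundedWindows`, `SaturationEnvelope.lateWindows`); the band is the `N`-uniform
dynamical content of E2. [folklore] -/
theorem subBallisticWindow_iff_coreBand :
    SubBallisticWindow ↔ ∃ (ℓ₀ : ℕ) (τ₀ : ℝ),
    (∀ ω₂ lam β γ : ℝ, 0 < ω₂ → 0 < lam → 0 < β → 0 < γ → ∀ T : ℝ, 0 < T → ∃ C : ℝ,
      ∀ (N k₁ k₂ : ℕ), k₁ ≤ k₂ → k₂ + 1 ≤ N → k₁ + ℓ₀ < k₂ → ∀ τ : ℝ, 0 ≤ τ → τ₀ < τ →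
      1 + τ < ((k₂ : ℝ) - k₁) * (((k₂ : ℝ) - k₁) + min (k₁ : ℝ) ((N : ℝ) - k₂)) →
      let P := pinnedChain ω₂ lam β γ;
      let P₀ := pinnedChain ω₂ lam β 0;
      let μT : Measure (PhaseSpace N) :=
        volume.withDensity (fun x : PhaseSpace N => ENNReal.ofReal (Real.exp (-(P.hamiltonian N x) / T)));
      let JB : PhaseSpace N → ℝ := fun z => ∑ i : Fin N,
        (if k₁ ≤ i.val ∧ i.val < k₂ then P.bondCurrent N i z else 0);
      ∫ x, (∫ t in Set.Ioc (0 : ℝ) τ, (∫ y, JB y ∂(P₀.transitionKernel N T T t.toNNReal x))) ^ 2 ∂μT ≤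
        C * (1 + τ) * ((k₂ : ℝ) - k₁) * ∫ x, Real.exp (-(P.hamiltonian N x) / T) ∂volume) :=
  ⟨fun h => ⟨0, 0, coreBand_of_subBallisticWindow 0 0 h⟩,
    fun ⟨ℓ₀, τ₀, h⟩ => subBallisticWindow_of_coreBand ℓ₀ τ₀ h⟩

end Summit.AtomisticToContinuum.FouriersLaw.Theorems.SubBallisticWindow.CoreBand

end
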